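import Summits.ABC.ABC.Theorems.DefiniteXiDefiniteRTControlPrimeOfTakahashi
import Literature.NumberTheory.EllipticCurves.PastenHeightBoundsLemma68LocalProofs
import HarnessLib

/-!
# Stub-ideation k2 · gen 16 — `stub_pastenLemma68` (crux `DefiniteRTControlPrime`, stmt-ABC-11338)

Companion to `STUB-IDEAS-stub_pastenLemma68-2.md` (gen 16).  FAMILY 2 (RESHAPE), typed and checked:

* §0  by-name certificates in TODAY's tree (re-stamped): the crux from Takahashi 2.3 alone (landed,
      p839521) — the stub is MOOT for the crux; the verbatim stub's only closer (Mazur–Kenku named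
      fact); the verbatim stub is Mazur-deep (prime isogeny degrees `≤ 163` at a multiplicative place).
* §1  **gen-16 RESHAPE T4 — the stub's RÔLE as ONE drop-in lemma with `stub_valTransport`'s binder
      shape and an `ε`-parametric constant**: `FreyValTransportSubpoly` (H8), PROVED here in ten
      lines from the two landed Mazur-free leaves `OfTakahashi.freyIsogenyRadiusSubpoly`
      (sub-polynomial rooted radius of a Frey class, unconditional) and
      `OfTakahashi.factorization_le_mul_of_isogeny` (one-isogeny Tate transport); plus its
      conductor-named form (H8′) matching the binders of the three OTHER consumers of
      `(h68 : PastenShimura2024_lemma_6_8)` in route DefiniteXi, so that each of H5–H7 (gen 15) is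
      the template proof with ONE `have` swapped.
No `sorry`.
-/

set_option linter.dupNamespace false

namespace Summit.ABC.ABC.Cruxes.DefiniteRTControlPrime.StubIdeasK2G16

open Literature.NumberTheory.EllipticCurves Literature.NumberTheory.EllipticCurves.ModularForms
open Literature.NumberTheory.Automorphic
open WeierstrassCurve IsDedekindDomain
open Summit.ABC.ABC.Theorems.DefiniteRTControlPrime

/-! ## §0 · Certificates (kernel-checked against today's tree) -/

/-- The crux from Takahashi 2001 Thm 2.3 (coprime form) ALONE — landed (p839521): the stub is moot
for the crux. -/
example (hT : takahashi2001_thm_2_3_of_coprime) :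
    Summit.ABC.ABC.Theses.DefiniteXi.DefiniteRTControlPrime :=
  definiteRTControlPrime_of_takahashi hT

/-- The verbatim stub's closer: the Mazur–Kenku named fact (tree). -/
example (hMK : mazurKenku_exists_cyclic_isogeny) : PastenShimura2024_lemma_6_8 :=
  PastenShimura2024_lemma_6_8_of_mazurKenku' hMK

/-- The verbatim stub is Mazur-deep AS TYPED (tree): it bounds prime isogeny degrees by `163` at a
multiplicative place (Mazur 1978 Thm 1 / Cor 4.4 at non-integral `j`). -/
example (h68 : PastenShimura2024_lemma_6_8) {W W' : WeierstrassCurve ℚ} [W.IsElliptic]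
    [W'.IsElliptic] (φ : Isogeny W W') {ℓ : ℕ} (hℓ : ℓ.Prime) (hdeg : φ.degree = ℓ)
    (v : HeightOneSpectrum ℤ) (hv : W.HasMultiplicativeReductionAt v) : ℓ ≤ 163 :=
  prime_degree_le_163_of_PastenShimura2024_lemma_6_8 h68 φ hℓ hdeg v hv

/-! ## §1 · gen-16 RESHAPE T4: the stub's rôle as ONE Mazur-free drop-in lemma -/

/-- **H8 (statement).** Sub-polynomial valuation transport out of a Frey class at an odd conductor
prime: for every `ε > 0` there is `R` with
`v_q(Δ_min W') ≤ R · N^ε · v_q(Δ_min E_(a,b))` for every `W'` that is `ℚ`-isogenous to `E_(a,b)`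
(`N` the conductor).  This is `stub_valTransport`'s conclusion (`FreyValTransport 163`) with the
Mazur constant `163` replaced by `R_ε N^ε` — the exact shape every consumer of
`PastenShimura2024_lemma_6_8` in route DefiniteXi can absorb into its idle `N^ε`. -/
def FreyValTransportSubpoly : Prop :=
  ∀ ε : ℝ, 0 < ε → ∃ R : ℝ, ∀ (a b : ℤ), IsCoprime a b → a * b * (a + b) ≠ 0 →
    ∀ q : ℕ, q.Prime → q ≠ 2 → q ∣ (freyCurve a b).conductorNorm ℤ →
    ∀ (W' : WeierstrassCurve ℚ) [W'.IsElliptic], (freyCurve a b).IsIsogenous W' →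
      (((W'.minimalDiscriminantNorm ℤ).factorization q : ℕ) : ℝ) ≤
        R * (((freyCurve a b).conductorNorm ℤ : ℕ) : ℝ) ^ ε *
          ((((freyCurve a b).minimalDiscriminantNorm ℤ).factorization q : ℕ) : ℝ)

/-- **H8 (PROVED, Mazur-free).** From the landed leaves: the radius isogeny `φ : E_(a,b) → W'` of
`OfTakahashi.freyIsogenyRadiusSubpoly` (`deg φ ≤ R N^ε`) and the one-isogeny Tate transport
`OfTakahashi.factorization_le_mul_of_isogeny` (`v_q(Δ_min W') ≤ deg φ · v_q(Δ_min E)`). -/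
theorem freyValTransportSubpoly : FreyValTransportSubpoly := by
  intro ε hε
  obtain ⟨R, hR⟩ := OfTakahashi.freyIsogenyRadiusSubpoly ε hε
  refine ⟨R, fun a b hab h0 q hq hq2 hqN W' _ hiso => ?_⟩
  haveI := isElliptic_freyCurve h0
  obtain ⟨φ, hφ⟩ := hR a b hab h0 q hq hq2 hqN W' hiso
  have hnat := OfTakahashi.factorization_le_mul_of_isogeny hab h0 hq hq2 hqN φ le_rfl
  have hcast : (((W'.minimalDiscriminantNorm ℤ).factorization q : ℕ) : ℝ) ≤
      (φ.degree : ℝ) * ((((freyCurve a b).minimalDiscriminantNorm ℤ).factorization q : ℕ) : ℝ) := by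
    exact_mod_cast hnat
  exact hcast.trans (mul_le_mul_of_nonneg_right hφ (Nat.cast_nonneg _))

/-- **H8′ (statement, conductor-named form)** — the binder shape of the consumers
(`… (N) [NeZero N], conductorNorm = N → ∀ q, q.Prime → q ≠ 2 → q ∣ N → …`). -/
def FreyValTransportSubpoly' : Prop :=
  ∀ ε : ℝ, 0 < ε → ∃ R : ℝ, ∀ (a b : ℤ), IsCoprime a b → a * b * (a + b) ≠ 0 →
    ∀ (N : ℕ) [NeZero N], (freyCurve a b).conductorNorm ℤ = N →
    ∀ q : ℕ, q.Prime → q ≠ 2 → q ∣ N →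
    ∀ (W' : WeierstrassCurve ℚ) [W'.IsElliptic], (freyCurve a b).IsIsogenous W' →
      (((W'.minimalDiscriminantNorm ℤ).factorization q : ℕ) : ℝ) ≤
        R * (N : ℝ) ^ ε * ((((freyCurve a b).minimalDiscriminantNorm ℤ).factorization q : ℕ) : ℝ)

/-- **H8′ (PROVED)** from H8 by renaming the conductor. -/
theorem freyValTransportSubpoly' : FreyValTransportSubpoly' := by
  intro ε hε
  obtain ⟨R, hR⟩ := freyValTransportSubpoly ε hε
  refine ⟨R, fun a b hab h0 N _ hN q hq hq2 hqN W' _ hiso => ?_⟩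
  have hqN' : q ∣ (freyCurve a b).conductorNorm ℤ := by rw [hN]; exact hqN
  have h := hR a b hab h0 q hq hq2 hqN' W' hiso
  rw [hN] at h
  exact h

/-- **H8 ⇒ the uniform shape at fixed `ε`, in `ℕ`-free `ℝ` form, for ONE curve** (how a template
proof consumes it: `obtain ⟨R, hR⟩ := freyValTransportSubpoly' ε hε` once, then at the pivot
`W⋆ ~ E` the line `hval := hR a b hab h0 N hN q hq hq2 hqN W⋆ hiso` replaces
`stub_valTransport h68 a b hab h0 q hq hq2 hqN' W⋆ hiso`). -/
example {ε : ℝ} (hε : 0 < ε) : ∃ R : ℝ, ∀ (a b : ℤ), IsCoprime a b → a * b * (a + b) ≠ 0 →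
    ∀ (N : ℕ) [NeZero N], (freyCurve a b).conductorNorm ℤ = N →
    ∀ q : ℕ, q.Prime → q ≠ 2 → q ∣ N →
    ∀ (W' : WeierstrassCurve ℚ) [W'.IsElliptic], (freyCurve a b).IsIsogenous W' →
      (((W'.minimalDiscriminantNorm ℤ).factorization q : ℕ) : ℝ) ≤
        R * (N : ℝ) ^ ε * ((((freyCurve a b).minimalDiscriminantNorm ℤ).factorization q : ℕ) : ℝ) :=
  freyValTransportSubpoly' ε hε

/-- **The uniform stub-shaped statement at constant `B`** (`FreyValTransport B`; `B = 163` is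
verbatim the conclusion of the skeleton's `stub_valTransport`), and its supplier from a rooted
radius — so the verbatim stub's rôle is `FreyValTransport 163 ⇐ FreyIsogenyRadius 163 ⇐` item
`MazurKenkuRadius` (stmt-ABC-15193), all by name. -/
def FreyValTransport (B : ℕ) : Prop :=
  ∀ (a b : ℤ), IsCoprime a b → a * b * (a + b) ≠ 0 → ∀ q : ℕ, q.Prime → q ≠ 2 →
    q ∣ (freyCurve a b).conductorNorm ℤ →
    ∀ (W' : WeierstrassCurve ℚ) [W'.IsElliptic], (freyCurve a b).IsIsogenous W' →
      (W'.minimalDiscriminantNorm ℤ).factorization q ≤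
        B * ((freyCurve a b).minimalDiscriminantNorm ℤ).factorization q

theorem freyValTransport_of_radius {R : ℕ} (hR : OfTakahashi.FreyIsogenyRadius R) :
    FreyValTransport R := by
  intro a b hab h0 q hq hq2 hqN W' _ hiso
  obtain ⟨φ, hφ⟩ := hR a b hab h0 q hq hq2 hqN W' hiso
  exact OfTakahashi.factorization_le_mul_of_isogeny hab h0 hq hq2 hqN φ hφ

/-- The skeleton's use of the stub, recovered from the route ITEM instead of the Literature fact. -/
theorem freyValTransport_163_of_radiusItem (h : Summit.ABC.ABC.Theses.DefiniteXi.MazurKenkuRadius) :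
    FreyValTransport 163 :=
  freyValTransport_of_radius (OfTakahashi.freyIsogenyRadius_of_mazurKenkuRadius h)

/-- … and from the verbatim stub (= the landed `stub_valTransport`, by name). -/
theorem freyValTransport_163_of_stub (h68 : PastenShimura2024_lemma_6_8) : FreyValTransport 163 :=
  fun a b hab h0 q hq hq2 hqN W' _ hiso => stub_valTransport h68 a b hab h0 q hq hq2 hqN W' hiso

end Summit.ABC.ABC.Cruxes.DefiniteRTControlPrime.StubIdeasK2G16
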